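import Summits.QuantumFields.BalabanUV.Beta.GAN24.ScalarSup110GWeight
import Summits.QuantumFields.BalabanUV.Beta.GAN24.ScalarFreeResolventDiagonal
import Summits.QuantumFields.BalabanUV.T4Continuum.Support.CTScalarGreen

/-!
# Row G-an2-4 ∕ (CONV-C), scalar currency — THE THREE TERMS of `G′ = P − a′PΠ′G′ + F^N G′` IN `ℓ^∞` BLOCK CURRENCY:
# (B1) the block mean of `G′J` through the tree's `ℓ²` Combes–Thomas bound with NO loss in `n`, (B) the middle term, (C) the remainder

NOT IN PRINT; OUR PROOF.  Cell `pub-balaban`, G-an2-4 crux team (coordinator ruling e34b3e0c (2)), seat `b2b-balaban-gan24-formalise-leaf-01`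
(gen 55); module 5 of the line (L0) = (s0) = (K₀ˢ) (INTERFACE REQUEST `HOME/INBOX.md` l.4418, road-P2 crux prover `b2b-balaban-gan24-p2`
gen 29; journal `CLAIMS.log` l.28990 ∕ l.29155).  With `F = (Δ + 1)⁻¹`, `P = Σ_{k<N} F^{k+1}`, module 1's identity
`G′ = P − a′·P·Π′·G′ + F^N·G′` splits `(G′J)(x)` for `supp J ⊆ B(y′)`, `|J| ≤ B`, `x ∈ B(y)` into three terms; the first is module 2's
block rows of `P`; THIS FILE bounds the other two, `n`-UNIFORMLY:
 (B1) **`norm_PiS_Gps_mulVec_le`** — THE POINT OF THE LINE: `Π′ = PiS` maps the BLOCK `ℓ²` norm to `ℓ^∞` with exactly the factor `n^{−(d+1)/2}`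
      that `‖J‖₂ ≤ n^{(d+1)/2}B` costs, so the tree's `ℓ²` Combes–Thomas bound `CTScalarGreen.opNorm_conjMat_Gps_le` with module 4's weight
      `ρ_c` (`Λ = 1`) gives `‖(Π′G′J)(z)‖ ≤ γw⁻¹(e^κ)²B·e^{−κ|blk z − ȳ′|_{T₁,∞}}`, `γw = γ′ − Jfree (d+1) a′ κ 1 > 0`;
 (B) **`termB_le`**: `‖(PΠ′G′J)(n·y+r)‖ ≤ 2Nλ^{−N}e^{κ(n−1)/n}·γw⁻¹(e^κ)²B·e^{−κ|y−y′|}` (module 2's `cosh` rows of `P`, module 4's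
      `re_mulVec_blockDecay_le`);
 (C) **`termC_le`**: `‖(F^N G′J)(n·y+r)‖ ≤ 2·3^{d+1}λ₂^{−N}e^{2κ(n−1)/n}·γw⁻¹(e^κ)²B·e^{−κ|y−y′|}` for `N ≥ d+1` (Cauchy–Schwarz against the
      weighted `ℓ²` norm of `G′J`; module 3's diagonal bound `|F^N(x,z)| ≤ 3^{d+1}n^{−(d+1)}` pays for `|B(y′)| = n^{d+1}`; rows of `F^N` with slope `2κ/n`);
 plus `norm_le_exp_mul_norm_wvec`, `nsq_wvec_Gps_mulVec_le` (`nsq(e^{κρ_c}G′J) ≤ γw⁻²(e^κ)²n^{d+1}B²`).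

HONEST SCOPE.  [folklore]-grade lattice analysis of the cell's typed `U = 1` objects; OUR proof, OUR crude constants; nothing printed by Bałaban is
used or asserted.  No `def`, no `def … : Prop`, no `sorry`.  NOT (CONV-C), NEVER «G-an2-4 closed», NOT NE2 ∕ NE3, NOT D1, NOT BetaPertH, NOT the
continuum limit, NOT Clay.  HONEST DEPENDENCY: continuum YM on T⁴ ⇐ BetaPertH ∧ nine spine estimates (0/9 proved); BetaPertH ⇐ (D1) ∧ (D4) ∧
CAP+tail; G-an2-4 gates asym, D1 and NE2/3/4.
-/

noncomputable section

open scoped BigOperators ComplexConjugate Matrix Matrix.Norms.L2Operator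
open Finset Complex Matrix

namespace Summit.QuantumFields.BalabanUV.Beta.GAN24.ScalarSup110GPieces

open Literature.MathematicalPhysics.QuantumFieldTheory.Balaban1983to89
open B5Prop11Plancherel (Tor fine)
open B5Prop11Lower (nsq nsq_nonneg nsq_mulVec_le)
open B5Action121 (LapS)
open B5Block118 (bpt)
open B5Blocks16 (blockOf blockOf_bpt)
open B6LowerBound2153Torus (toT rep toT_rep)
open B4TorusKernel.MultiPeriod (circAbs torusSupNorm torusSupNorm_nonneg)
open B6Cov2156Torus (one_le_M)
open B5G115SupBound (exists_eq_bpt_blockOf)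
open Beta.DeltaACombesThomas (sq_mul_cosh_div_sub_one_le)
open Summit.QuantumFields.BalabanUV.T4Continuum
open Summit.QuantumFields.BalabanUV.T4Continuum.ScalarBlockPoincare (PiS)
open Summit.QuantumFields.BalabanUV.T4Continuum.ScalarAveragedPropagator (Gps gammaPs gammaPs_pos)
open Summit.QuantumFields.BalabanUV.T4Continuum.ScalarCovariantCTWeighted (wvec)
open Summit.QuantumFields.BalabanUV.T4Continuum.CTWeightedCoercivity (conjMat wvec_mulVec)
open Summit.QuantumFields.BalabanUV.T4Continuum.ScalarCovariantCTDefects (PiS_apply sum_ite_blockOf_eq)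
open Summit.QuantumFields.BalabanUV.T4Continuum.CTScalarGreen (Jfree Jfree_nonneg opNorm_conjMat_Gps_le)
open Summit.QuantumFields.BalabanUV.Beta.GAN24.ScalarFreeResolvent
open Summit.QuantumFields.BalabanUV.Beta.GAN24.ScalarFreeResolventRows
open Summit.QuantumFields.BalabanUV.Beta.GAN24.ScalarFreeResolventDiagonal
open Summit.QuantumFields.BalabanUV.Beta.GAN24.ScalarSup110GWeight

variable {d : ℕ}

/-! ## §1 The three terms -/

section Pieces

variable (n : ℕ) [NeZero n] (M : Fin (d + 1) → ℕ) [hM : ∀ μ, NeZero (M μ)] {a' : ℝ}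

/-- **(B1) THE BLOCK MEAN OF `G′J` IS `ℓ^∞`-SMALL WITH DECAY, `n`-UNIFORMLY**: for `supp J ⊆ B(y′)`, `|J| ≤ B`, `κ ≥ 0` with
`Jfree (d+1) a′ κ 1 < γ′`: `‖(Π′G′J)(z)‖ ≤ γw⁻¹·(e^κ)²·B·e^{−κ|blk z − ȳ′|_{T₁,∞}}`, `γw = γ′ − Jfree` (block Cauchy–Schwarz gains `n^{−(d+1)/2}`,
the `ℓ²` Combes–Thomas bound of the tree with the weight `ρ_c` of module 4, `|B(y′)|^{1/2} = n^{(d+1)/2}`). [folklore] -/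
theorem norm_PiS_Gps_mulVec_le (ha' : 0 < a') {κ : ℝ} (hκ : 0 ≤ κ) (hγ : Jfree (d + 1) a' κ 1 < gammaPs (d + 1) a')
    (y' : Fin (d + 1) → ℤ) (J : Tor (fine n M) → ℂ) {B : ℝ} (hJB : ∀ z, ‖J z‖ ≤ B)
    (hsupp : ∀ z, J z ≠ 0 → ∃ r' : Fin (d + 1) → Fin n, z = bpt n M (toT M y') r') (z'' : Tor (fine n M)) :
    ‖(PiS n M *ᵥ (Gps n M a' *ᵥ J)) z''‖
      ≤ (gammaPs (d + 1) a' - Jfree (d + 1) a' κ 1)⁻¹ * Real.exp κ ^ 2 * B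
        * Real.exp (-(κ * torusSupNorm M (rep M (blockOf n M z'') - rep M (toT M y')))) := by
  have hn : (0 : ℝ) < n := by exact_mod_cast Nat.pos_of_ne_zero (NeZero.ne n)
  have hnD : (0 : ℝ) < (n : ℝ) ^ (d + 1) := pow_pos hn _
  set γw := gammaPs (d + 1) a' - Jfree (d + 1) a' κ 1 with hγw
  have hγw : 0 < γw := by rw [hγw]; linarith
  -- the weight of the line, anchored in the block `B(y′)`
  set r₀ : Fin (d + 1) → Fin n := fun _ => ⟨0, Nat.pos_of_ne_zero (NeZero.ne n)⟩ with hr₀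
  set c := bpt n M (toT M y') r₀ with hc
  set ρ : Tor (fine n M) → ℝ := fun z => ((n : ℝ))⁻¹ * torusSupNorm (fine n M) (rep (fine n M) z - rep (fine n M) c) with hρ
  have hlip : ∀ x ν, |ρ (x + B5Prop11Plancherel.unitVec (fine n M) ν) - ρ x| ≤ 1 / n := fun x ν => rho_lipschitz n M c x ν
  have hosc : ∀ x x', blockOf n M x = blockOf n M x' → |ρ x - ρ x'| ≤ 1 := fun x x' h => rho_osc n M c x x' h
  have hCT := opNorm_conjMat_Gps_le n M ha' hlip hosc hγ
  -- `g = G′J`, `w = e^{κρ}g = (conj G′)(e^{κρ}J)`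
  set g := Gps n M a' *ᵥ J with hg
  set w := wvec κ ρ g with hw
  have hw_eq : w = conjMat κ ρ ρ (Gps n M a') *ᵥ wvec κ ρ J := by rw [hw, hg]; exact wvec_mulVec κ ρ ρ _ _
  have hB0 : 0 ≤ B := (norm_nonneg _).trans (hJB c)
  -- `nsq w ≤ γw⁻² (e^κ)² n^D B²`
  have hnsqw : nsq w ≤ (γw⁻¹) ^ 2 * (Real.exp κ ^ 2 * ((n : ℝ) ^ (d + 1) * B ^ 2)) := by
    rw [hw_eq]
    refine (nsq_mulVec_le _ _).trans ?_
    have hJ2 := nsq_wvec_le_of_block_support n M hκ ρ y' (fun r' => rho_anchor_block_le n M y' r₀ r') J hJB hsupp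
    exact mul_le_mul (pow_le_pow_left₀ (norm_nonneg _) hCT 2) hJ2 (nsq_nonneg _) (by positivity)
  -- the block indicator of `blk z″` and the lower bound of `ρ` there
  set b := blockOf n M z'' with hb
  set m := torusSupNorm M (rep M b - rep M (toT M y')) - 1 with hm
  have hρm : ∀ z, blockOf n M z = b → m ≤ ρ z := by
    intro z hz
    have h := rho_ge n M y' r₀ z
    rw [hz] at h
    exact h
  -- `‖g z‖ = e^{−κρ z}‖w z‖ ≤ e^{−κ m}‖w z‖` on the block
  have hgw : ∀ z, blockOf n M z = b → ‖g z‖ ≤ Real.exp (-(κ * m)) * ‖w z‖ := by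
    intro z hz
    have e1 : ‖w z‖ = Real.exp (κ * ρ z) * ‖g z‖ := by
      rw [hw, wvec, norm_mul, Complex.norm_real, Real.norm_of_nonneg (Real.exp_pos _).le]
    rw [e1, ← mul_assoc, ← Real.exp_add]
    have h2 : 1 ≤ Real.exp (-(κ * m) + κ * ρ z) := Real.one_le_exp (by nlinarith [hρm z hz])
    exact le_mul_of_one_le_left (norm_nonneg _) h2
  -- `‖(Π′g)(z″)‖ ≤ n^{−D} Σ_{blk} ‖g‖`
  have hPi : ‖(PiS n M *ᵥ g) z''‖ ≤ ((n : ℝ) ^ (d + 1))⁻¹ * ∑ z, (if blockOf n M z = b then (1 : ℝ) else 0) * ‖g z‖ := by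
    simp only [Matrix.mulVec, dotProduct]
    refine (norm_sum_le _ _).trans ?_
    rw [Finset.mul_sum]
    refine Finset.sum_le_sum fun z _ => ?_
    rw [PiS_apply, norm_mul]
    by_cases hz : blockOf n M z = b
    · have h' : blockOf n M z'' = blockOf n M z := (hz.trans hb).symm
      rw [if_pos h', if_pos hz, norm_div, norm_one, norm_pow, Complex.norm_natCast, one_mul, one_div]
    · have h' : ¬ blockOf n M z'' = blockOf n M z := fun h => hz (h.symm.trans hb.symm)
      rw [if_neg h', if_neg hz, norm_zero, zero_mul, mul_zero]
  -- Cauchy–Schwarz on the block: `(Σ_{blk} ‖w‖)² ≤ n^D · nsq w`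
  have hCS : (∑ z, (if blockOf n M z = b then (1 : ℝ) else 0) * ‖w z‖) ^ 2 ≤ (n : ℝ) ^ (d + 1) * nsq w := by
    have h := Finset.sum_mul_sq_le_sq_mul_sq Finset.univ (fun z => if blockOf n M z = b then (1 : ℝ) else 0) (fun z => ‖w z‖)
    have hind : ∑ z : Tor (fine n M), (if blockOf n M z = b then (1 : ℝ) else 0) ^ 2 = (n : ℝ) ^ (d + 1) := by
      have e : ∀ z : Tor (fine n M), (if blockOf n M z = b then (1 : ℝ) else 0) ^ 2 = if blockOf n M z = b then (1 : ℝ) else 0 := by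
        intro z; split_ifs <;> norm_num
      rw [Finset.sum_congr rfl fun z _ => e z, sum_ite_blockOf_eq n M b 1, mul_one]
    rw [hind] at h
    unfold nsq
    exact h
  -- assemble: `‖u‖² ≤ (n^{−D})²·e^{−2κm}·n^D·nsq w ≤ (γw⁻¹ e^κ e^{−κm} B)²`
  set X := γw⁻¹ * Real.exp κ ^ 2 * B * Real.exp (-(κ * torusSupNorm M (rep M b - rep M (toT M y')))) with hX
  have hX0 : 0 ≤ X := by rw [hX]; positivity
  have hXe : X = γw⁻¹ * Real.exp κ * B * (Real.exp (-(κ * m))) := by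
    rw [hX, hm, show -(κ * (torusSupNorm M (rep M b - rep M (toT M y')) - 1)) = κ + -(κ * torusSupNorm M (rep M b - rep M (toT M y'))) by ring,
      Real.exp_add]
    ring
  have hS : ∑ z, (if blockOf n M z = b then (1 : ℝ) else 0) * ‖g z‖ ≤ Real.exp (-(κ * m)) * ∑ z, (if blockOf n M z = b then (1 : ℝ) else 0) * ‖w z‖ := by
    rw [Finset.mul_sum]
    refine Finset.sum_le_sum fun z _ => ?_
    by_cases hz : blockOf n M z = b
    · rw [if_pos hz, one_mul, one_mul]; exact hgw z hz
    · rw [if_neg hz, zero_mul, zero_mul, mul_zero]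
  have hsq : ‖(PiS n M *ᵥ g) z''‖ ^ 2 ≤ X ^ 2 := by
    have h1 : ‖(PiS n M *ᵥ g) z''‖ ≤ ((n : ℝ) ^ (d + 1))⁻¹ * (Real.exp (-(κ * m)) * ∑ z, (if blockOf n M z = b then (1 : ℝ) else 0) * ‖w z‖) :=
      hPi.trans (mul_le_mul_of_nonneg_left hS (by positivity))
    have hT0 : 0 ≤ ∑ z, (if blockOf n M z = b then (1 : ℝ) else 0) * ‖w z‖ :=
      Finset.sum_nonneg fun z _ => mul_nonneg (by split_ifs <;> norm_num) (norm_nonneg _)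
    calc ‖(PiS n M *ᵥ g) z''‖ ^ 2
        ≤ (((n : ℝ) ^ (d + 1))⁻¹ * (Real.exp (-(κ * m)) * ∑ z, (if blockOf n M z = b then (1 : ℝ) else 0) * ‖w z‖)) ^ 2 :=
          pow_le_pow_left₀ (norm_nonneg _) h1 2
      _ = (((n : ℝ) ^ (d + 1))⁻¹) ^ 2 * Real.exp (-(κ * m)) ^ 2 * (∑ z, (if blockOf n M z = b then (1 : ℝ) else 0) * ‖w z‖) ^ 2 := by ring
      _ ≤ (((n : ℝ) ^ (d + 1))⁻¹) ^ 2 * Real.exp (-(κ * m)) ^ 2 * ((n : ℝ) ^ (d + 1) * ((γw⁻¹) ^ 2 * (Real.exp κ ^ 2 * ((n : ℝ) ^ (d + 1) * B ^ 2)))) :=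
          mul_le_mul_of_nonneg_left (hCS.trans (mul_le_mul_of_nonneg_left hnsqw hnD.le)) (by positivity)
      _ = X ^ 2 := by rw [hXe]; field_simp
  exact (pow_le_pow_iff_left₀ (norm_nonneg _) hX0 two_ne_zero).mp hsq

/-- the pointwise Combes–Thomas reading of `g = G′J`: `‖g z‖ ≤ e^κ·e^{−κ|blk z − ȳ′|_{T₁,∞}}·‖(e^{κρ_c}g)(z)‖` for the weight `ρ_c` anchored at
`c = n·y′ + r₀` (module 4's `rho_ge`), `κ ≥ 0`. [folklore] -/
theorem norm_le_exp_mul_norm_wvec {κ : ℝ} (hκ : 0 ≤ κ) (y' : Fin (d + 1) → ℤ) (r₀ : Fin (d + 1) → Fin n)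
    (g : Tor (fine n M) → ℂ) (z : Tor (fine n M)) :
    ‖g z‖ ≤ Real.exp κ * Real.exp (-(κ * torusSupNorm M (rep M (blockOf n M z) - rep M (toT M y'))))
      * ‖wvec κ (fun z => ((n : ℝ))⁻¹ * torusSupNorm (fine n M) (rep (fine n M) z - rep (fine n M) (bpt n M (toT M y') r₀))) g z‖ := by
  have hρ := rho_ge n M y' r₀ z
  rw [wvec, norm_mul, Complex.norm_real, Real.norm_of_nonneg (Real.exp_pos _).le, ← mul_assoc, ← Real.exp_add, ← mul_assoc,
    ← Real.exp_add]
  refine le_mul_of_one_le_left (norm_nonneg _) (Real.one_le_exp ?_)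
  have h2 : 0 ≤ κ * (((n : ℝ))⁻¹ * torusSupNorm (fine n M) (rep (fine n M) z - rep (fine n M) (bpt n M (toT M y') r₀))
      - (torusSupNorm M (rep M (blockOf n M z) - rep M (toT M y')) - 1)) := mul_nonneg hκ (by linarith)
  nlinarith [h2]

/-- the weighted `ℓ²` norm of `G′J`: `nsq (e^{κρ_c}·G′J) ≤ γw⁻²·(e^κ)²·n^{d+1}·B²` (the tree's `ℓ²` Combes–Thomas bound
`CTScalarGreen.opNorm_conjMat_Gps_le` with module 4's weight; `γw = γ′ − Jfree (d+1) a′ κ 1 > 0`). [folklore] -/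
theorem nsq_wvec_Gps_mulVec_le (ha' : 0 < a') {κ : ℝ} (hκ : 0 ≤ κ) (hγ : Jfree (d + 1) a' κ 1 < gammaPs (d + 1) a')
    (y' : Fin (d + 1) → ℤ) (r₀ : Fin (d + 1) → Fin n) (J : Tor (fine n M) → ℂ) {B : ℝ} (hJB : ∀ z, ‖J z‖ ≤ B)
    (hsupp : ∀ z, J z ≠ 0 → ∃ r' : Fin (d + 1) → Fin n, z = bpt n M (toT M y') r') :
    nsq (wvec κ (fun z => ((n : ℝ))⁻¹ * torusSupNorm (fine n M) (rep (fine n M) z - rep (fine n M) (bpt n M (toT M y') r₀)))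
        (Gps n M a' *ᵥ J))
      ≤ ((gammaPs (d + 1) a' - Jfree (d + 1) a' κ 1)⁻¹) ^ 2 * (Real.exp κ ^ 2 * ((n : ℝ) ^ (d + 1) * B ^ 2)) := by
  set c := bpt n M (toT M y') r₀ with hc
  set ρ : Tor (fine n M) → ℝ := fun z => ((n : ℝ))⁻¹ * torusSupNorm (fine n M) (rep (fine n M) z - rep (fine n M) c) with hρ
  have hlip : ∀ x ν, |ρ (x + B5Prop11Plancherel.unitVec (fine n M) ν) - ρ x| ≤ 1 / n := fun x ν => rho_lipschitz n M c x ν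
  have hosc : ∀ x x', blockOf n M x = blockOf n M x' → |ρ x - ρ x'| ≤ 1 := fun x x' h => rho_osc n M c x x' h
  have hCT := opNorm_conjMat_Gps_le n M ha' hlip hosc hγ
  rw [wvec_mulVec κ ρ ρ]
  refine (nsq_mulVec_le _ _).trans ?_
  have hJ2 := nsq_wvec_le_of_block_support n M hκ ρ y' (fun r' => rho_anchor_block_le n M y' r₀ r') J hJB hsupp
  exact mul_le_mul (pow_le_pow_left₀ (norm_nonneg _) hCT 2) hJ2 (nsq_nonneg _) (by positivity)

/-- **(B) THE MIDDLE TERM**: `‖(P·Π′·G′J)(n·y + r)‖ ≤ 2Nλ^{−N}e^{κ(n−1)/n}·γw⁻¹(e^κ)²B·e^{−κ|y − y′|_{T₁,∞}}` (B1 + module 2's rows of `P`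
with slope `κ/n` through module 4's `re_mulVec_blockDecay_le`). [folklore] -/
theorem termB_le (ha' : 0 < a') {κ : ℝ} (hκ : 0 ≤ κ) (hγ : Jfree (d + 1) a' κ 1 < gammaPs (d + 1) a')
    (hlam : 0 < 1 - 2 * (d + 1) * (n : ℝ) ^ 2 * (Real.cosh (κ / n) - 1)) (Nn : ℕ)
    (y y' : Fin (d + 1) → ℤ) (r : Fin (d + 1) → Fin n) (J : Tor (fine n M) → ℂ) {B : ℝ} (hJB : ∀ z, ‖J z‖ ≤ B)
    (hsupp : ∀ z, J z ≠ 0 → ∃ r' : Fin (d + 1) → Fin n, z = bpt n M (toT M y') r') :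
    ‖(((∑ k ∈ Finset.range Nn, ((LapS (fine n M) (n : ℂ) + 1)⁻¹) ^ (k + 1)) * PiS n M * Gps n M a') *ᵥ J) (bpt n M (toT M y) r)‖
      ≤ 2 * (Nn * ((1 - 2 * (d + 1) * (n : ℝ) ^ 2 * (Real.cosh (κ / n) - 1))⁻¹) ^ Nn) * Real.exp (κ / n * ((n : ℝ) - 1))
          * ((gammaPs (d + 1) a' - Jfree (d + 1) a' κ 1)⁻¹ * Real.exp κ ^ 2 * B)
          * Real.exp (-(κ * torusSupNorm M (y - y'))) := by
  have hn : (0 : ℝ) < n := by exact_mod_cast Nat.pos_of_ne_zero (NeZero.ne n)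
  set P := ∑ k ∈ Finset.range Nn, ((LapS (fine n M) (n : ℂ) + 1)⁻¹) ^ (k + 1) with hP
  set u := PiS n M *ᵥ (Gps n M a' *ᵥ J) with hu
  set x := bpt n M (toT M y) r with hx
  set Cu := (gammaPs (d + 1) a' - Jfree (d + 1) a' κ 1)⁻¹ * Real.exp κ ^ 2 * B with hCu
  have hCu0 : 0 ≤ Cu := by
    have hB0 : 0 ≤ B := (norm_nonneg _).trans (hJB x)
    have hγw : 0 < gammaPs (d + 1) a' - Jfree (d + 1) a' κ 1 := by linarith
    rw [hCu]; positivity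
  have hmul : (P * PiS n M * Gps n M a') *ᵥ J = P *ᵥ u := by
    rw [Matrix.mul_assoc, ← Matrix.mulVec_mulVec, ← Matrix.mulVec_mulVec]
  rw [hmul]
  -- domination of `u` by the decaying majorant of (B1)
  set g₂ : Tor (fine n M) → ℝ := fun z => Cu * Real.exp (-(κ * torusSupNorm M (rep M (blockOf n M z) - rep M (toT M y')))) with hg₂
  have hug : ∀ z, ‖u z‖ ≤ g₂ z := fun z => by
    rw [hg₂, hu]; exact norm_PiS_Gps_mulVec_le n M ha' hκ hγ y' J hJB hsupp z
  have h1 := norm_mulVec_le_re_mulVec n M P (resolventPoly_apply_im_re n M Nn) u g₂ hug x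
  have h2 : ((P *ᵥ fun j => (g₂ j : ℂ)) x).re
      = Cu * ∑ z, (P x z).re * Real.exp (-(κ / n * n * torusSupNorm M (rep M (blockOf n M z) - rep M (toT M y')))) := by
    rw [div_mul_cancel₀ κ hn.ne']
    simp only [Matrix.mulVec, dotProduct, Complex.re_sum, Complex.re_mul_ofReal, hg₂, Finset.mul_sum]
    exact Finset.sum_congr rfl fun z _ => by ring
  have h3 := re_mulVec_blockDecay_le n M P (resolventPoly_apply_im_re n M Nn) (div_nonneg hκ hn.le) y y' r
    (re_resolventPoly_mulVec_cosh_le n M hlam Nn y r)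
  rw [div_mul_cancel₀ κ hn.ne'] at h3 h2
  rw [h2] at h1
  calc ‖(P *ᵥ u) x‖ ≤ Cu * ∑ z, (P x z).re * Real.exp (-(κ * torusSupNorm M (rep M (blockOf n M z) - rep M (toT M y')))) := h1
    _ ≤ Cu * (2 * (Nn * ((1 - 2 * (d + 1) * (n : ℝ) ^ 2 * (Real.cosh (κ / n) - 1))⁻¹) ^ Nn) * Real.exp (κ / n * ((n : ℝ) - 1))
          * Real.exp (-(κ * torusSupNorm M (y - y')))) := mul_le_mul_of_nonneg_left h3 hCu0
    _ = _ := by ring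

/-- **(C) THE REMAINDER**: for `N ≥ d + 1`,
`‖(F^N·G′J)(n·y + r)‖ ≤ 2·3^{d+1}λ₂^{−N}e^{2κ(n−1)/n}·γw⁻¹(e^κ)²B·e^{−κ|y − y′|_{T₁,∞}}` (Cauchy–Schwarz against the weighted `ℓ²` norm of
`G′J`; module 3's diagonal bound pays for `|B(y′)| = n^{d+1}`; module 2's rows of `F^N` with slope `2κ/n`). [folklore] -/
theorem termC_le (ha' : 0 < a') {κ : ℝ} (hκ : 0 ≤ κ) (hγ : Jfree (d + 1) a' κ 1 < gammaPs (d + 1) a')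
    (hlam2 : 0 < 1 - 2 * (d + 1) * (n : ℝ) ^ 2 * (Real.cosh (2 * κ / n) - 1)) {Nn : ℕ} (hN : d + 1 ≤ Nn)
    (y y' : Fin (d + 1) → ℤ) (r : Fin (d + 1) → Fin n) (J : Tor (fine n M) → ℂ) {B : ℝ} (hJB : ∀ z, ‖J z‖ ≤ B)
    (hsupp : ∀ z, J z ≠ 0 → ∃ r' : Fin (d + 1) → Fin n, z = bpt n M (toT M y') r') :
    ‖((((LapS (fine n M) (n : ℂ) + 1)⁻¹) ^ Nn * Gps n M a') *ᵥ J) (bpt n M (toT M y) r)‖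
      ≤ (2 * 3 ^ (d + 1) * ((1 - 2 * (d + 1) * (n : ℝ) ^ 2 * (Real.cosh (2 * κ / n) - 1))⁻¹) ^ Nn * Real.exp (2 * κ / n * ((n : ℝ) - 1)))
          * ((gammaPs (d + 1) a' - Jfree (d + 1) a' κ 1)⁻¹ * Real.exp κ ^ 2 * B)
          * Real.exp (-(κ * torusSupNorm M (y - y'))) := by
  have hn : (0 : ℝ) < n := by exact_mod_cast Nat.pos_of_ne_zero (NeZero.ne n)
  have hnD : (0 : ℝ) < (n : ℝ) ^ (d + 1) := pow_pos hn _
  set F := (LapS (fine n M) (n : ℂ) + 1)⁻¹ with hF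
  set x := bpt n M (toT M y) r with hx
  set γw := gammaPs (d + 1) a' - Jfree (d + 1) a' κ 1 with hγw
  have hγw0 : 0 < γw := by rw [hγw]; linarith
  have hB0 : 0 ≤ B := (norm_nonneg _).trans (hJB x)
  set r₀ : Fin (d + 1) → Fin n := fun _ => ⟨0, Nat.pos_of_ne_zero (NeZero.ne n)⟩ with hr₀
  set g := Gps n M a' *ᵥ J with hg
  set w := wvec κ (fun z => ((n : ℝ))⁻¹ * torusSupNorm (fine n M) (rep (fine n M) z - rep (fine n M) (bpt n M (toT M y') r₀))) g
    with hw
  set lam := ((1 - 2 * (d + 1) * (n : ℝ) ^ 2 * (Real.cosh (2 * κ / n) - 1))⁻¹) with hlam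
  set T := torusSupNorm M (y - y') with hT
  -- the two Cauchy–Schwarz factors
  set av : Tor (fine n M) → ℝ := fun z => ((F ^ Nn) x z).re
    * Real.exp (-(κ * torusSupNorm M (rep M (blockOf n M z) - rep M (toT M y')))) with hav
  set bv : Tor (fine n M) → ℝ := fun z => ‖w z‖ with hbv
  have hav0 : ∀ z, 0 ≤ av z := fun z => by rw [hav]; exact mul_nonneg (inv_pow_apply_im_re n M Nn x z).2 (Real.exp_pos _).le
  -- (1) `‖(F^N g)(x)‖ ≤ e^κ · Σ_z a_z b_z`
  have hmul : (F ^ Nn * Gps n M a') *ᵥ J = (F ^ Nn) *ᵥ g := by rw [hg, Matrix.mulVec_mulVec]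
  have h1 : ‖((F ^ Nn) *ᵥ g) x‖ ≤ Real.exp κ * ∑ z, av z * bv z := by
    calc ‖((F ^ Nn) *ᵥ g) x‖ = ‖∑ z, (F ^ Nn) x z * g z‖ := by simp only [Matrix.mulVec, dotProduct]
      _ ≤ ∑ z, ‖(F ^ Nn) x z * g z‖ := norm_sum_le _ _
      _ ≤ ∑ z, ((F ^ Nn) x z).re * (Real.exp κ * Real.exp (-(κ * torusSupNorm M (rep M (blockOf n M z) - rep M (toT M y')))) * bv z) := by
          refine Finset.sum_le_sum fun z _ => ?_
          rw [norm_mul, norm_inv_pow_apply]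
          exact mul_le_mul_of_nonneg_left (norm_le_exp_mul_norm_wvec n M hκ y' r₀ g z) (inv_pow_apply_im_re n M Nn x z).2
      _ = Real.exp κ * ∑ z, av z * bv z := by
          rw [Finset.mul_sum]; exact Finset.sum_congr rfl fun z _ => by rw [hav]; ring
  -- (2) `Σ b² ≤ γw⁻² (e^κ)² n^D B²`
  have hb2 : ∑ z, bv z ^ 2 ≤ (γw⁻¹) ^ 2 * (Real.exp κ ^ 2 * ((n : ℝ) ^ (d + 1) * B ^ 2)) := by
    have h := nsq_wvec_Gps_mulVec_le n M ha' hκ hγ y' r₀ J hJB hsupp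
    rw [← hg, ← hw] at h
    unfold nsq at h
    exact h
  -- (3) `Σ a² ≤ 3^D n^{−D} · e^{2κ} · 2λ₂^{−N} e^{(2κ/n)(n−1)} e^{−2κT}`
  have hdiag : ∀ z, ((F ^ Nn) x z).re ≤ 3 ^ (d + 1) * ((n : ℝ) ^ (d + 1))⁻¹ := fun z => by
    rw [← norm_inv_pow_apply]; exact norm_inv_pow_apply_le n M hN x z
  have ha2 : ∑ z, av z ^ 2 ≤ 3 ^ (d + 1) * ((n : ℝ) ^ (d + 1))⁻¹
      * (2 * lam ^ Nn * Real.exp (2 * κ / n * ((n : ℝ) - 1)) * Real.exp (-(2 * κ * T))) := by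
    -- `a_z² ≤ (3^D n^{−D})·Re F^N(x,z)·e^{−2κ t_z}`
    have hpt : ∀ z, av z ^ 2 ≤ 3 ^ (d + 1) * ((n : ℝ) ^ (d + 1))⁻¹
        * (((F ^ Nn) x z).re * Real.exp (-(2 * κ / n * n * torusSupNorm M (rep M (blockOf n M z) - rep M (toT M y'))))) := by
      intro z
      have hre0 := (inv_pow_apply_im_re n M Nn x z).2
      rw [div_mul_cancel₀ (2 * κ) hn.ne', hav, mul_pow, sq, sq, ← Real.exp_add,
        show -(κ * torusSupNorm M (rep M (blockOf n M z) - rep M (toT M y'))) + -(κ * torusSupNorm M (rep M (blockOf n M z) - rep M (toT M y')))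
          = -(2 * κ * torusSupNorm M (rep M (blockOf n M z) - rep M (toT M y'))) by ring]
      have h4 : ((F ^ Nn) x z).re * ((F ^ Nn) x z).re ≤ 3 ^ (d + 1) * ((n : ℝ) ^ (d + 1))⁻¹ * ((F ^ Nn) x z).re :=
        mul_le_mul_of_nonneg_right (hdiag z) hre0
      calc ((F ^ Nn) x z).re * ((F ^ Nn) x z).re * Real.exp (-(2 * κ * torusSupNorm M (rep M (blockOf n M z) - rep M (toT M y'))))
          ≤ 3 ^ (d + 1) * ((n : ℝ) ^ (d + 1))⁻¹ * ((F ^ Nn) x z).re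
              * Real.exp (-(2 * κ * torusSupNorm M (rep M (blockOf n M z) - rep M (toT M y')))) :=
            mul_le_mul_of_nonneg_right h4 (Real.exp_pos _).le
        _ = _ := by ring
    have hdec := re_mulVec_blockDecay_le n M (F ^ Nn) (inv_pow_apply_im_re n M Nn) (a := 2 * κ / n) (by positivity) y y' r
      (re_inv_pow_mulVec_cosh_le n M hlam2 Nn y r)
    calc ∑ z, av z ^ 2 ≤ ∑ z, 3 ^ (d + 1) * ((n : ℝ) ^ (d + 1))⁻¹
          * (((F ^ Nn) x z).re * Real.exp (-(2 * κ / n * n * torusSupNorm M (rep M (blockOf n M z) - rep M (toT M y'))))) :=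
          Finset.sum_le_sum fun z _ => hpt z
      _ = 3 ^ (d + 1) * ((n : ℝ) ^ (d + 1))⁻¹
          * ∑ z, ((F ^ Nn) x z).re * Real.exp (-(2 * κ / n * n * torusSupNorm M (rep M (blockOf n M z) - rep M (toT M y')))) := by
          rw [Finset.mul_sum]
      _ ≤ 3 ^ (d + 1) * ((n : ℝ) ^ (d + 1))⁻¹ * (2 * lam ^ Nn * Real.exp (2 * κ / n * ((n : ℝ) - 1)) * Real.exp (-(2 * κ / n * n * T))) :=
          mul_le_mul_of_nonneg_left hdec (by positivity)
      _ = _ := by rw [div_mul_cancel₀ (2 * κ) hn.ne']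
  -- (4) Cauchy–Schwarz and the square root
  have hCS := Finset.sum_mul_sq_le_sq_mul_sq Finset.univ av bv
  set q := 2 * 3 ^ (d + 1) * lam ^ Nn * Real.exp (2 * κ / n * ((n : ℝ) - 1)) with hq
  have hlam1 : 1 ≤ lam := by
    rw [hlam]
    refine (one_le_inv₀ hlam2).mpr ?_
    have h1 := Real.one_le_cosh (2 * κ / n)
    have h2 : (0 : ℝ) ≤ 2 * (d + 1) * (n : ℝ) ^ 2 := by positivity
    nlinarith
  have hq1 : 1 ≤ q := by
    rw [hq]
    have h3 : (1 : ℝ) ≤ 3 ^ (d + 1) := one_le_pow₀ (by norm_num)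
    have h4 : (1 : ℝ) ≤ lam ^ Nn := one_le_pow₀ hlam1
    have h5 : (1 : ℝ) ≤ Real.exp (2 * κ / n * ((n : ℝ) - 1)) := Real.one_le_exp (by
      have : (1 : ℝ) ≤ n := by exact_mod_cast Nat.one_le_iff_ne_zero.mpr (NeZero.ne n)
      exact mul_nonneg (by positivity) (by linarith))
    nlinarith [mul_le_mul h3 h4 zero_le_one (by positivity), mul_le_mul (mul_le_mul h3 h4 zero_le_one (by positivity)) h5 zero_le_one (by positivity)]
  set Z := q * (γw⁻¹ * Real.exp κ * B * Real.exp (-(κ * T))) with hZ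
  have hZ0 : 0 ≤ Z := by rw [hZ, hq]; positivity
  have hsq : (∑ z, av z * bv z) ^ 2 ≤ Z ^ 2 := by
    have hY : (∑ z, av z ^ 2) * (∑ z, bv z ^ 2)
        ≤ (3 ^ (d + 1) * ((n : ℝ) ^ (d + 1))⁻¹ * (2 * lam ^ Nn * Real.exp (2 * κ / n * ((n : ℝ) - 1)) * Real.exp (-(2 * κ * T))))
          * ((γw⁻¹) ^ 2 * (Real.exp κ ^ 2 * ((n : ℝ) ^ (d + 1) * B ^ 2))) :=
      mul_le_mul ha2 hb2 (Finset.sum_nonneg fun z _ => sq_nonneg _) (by positivity)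
    have hqq : q ≤ q ^ 2 := le_self_pow₀ hq1 two_ne_zero
    have e1 : (3 ^ (d + 1) * ((n : ℝ) ^ (d + 1))⁻¹ * (2 * lam ^ Nn * Real.exp (2 * κ / n * ((n : ℝ) - 1)) * Real.exp (-(2 * κ * T))))
          * ((γw⁻¹) ^ 2 * (Real.exp κ ^ 2 * ((n : ℝ) ^ (d + 1) * B ^ 2)))
        = q * (γw⁻¹ * Real.exp κ * B * Real.exp (-(κ * T))) ^ 2 := by
      rw [hq, show -(2 * κ * T) = -(κ * T) + -(κ * T) by ring, Real.exp_add]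
      field_simp
    rw [e1] at hY
    have e2 : Z ^ 2 = q ^ 2 * (γw⁻¹ * Real.exp κ * B * Real.exp (-(κ * T))) ^ 2 := by rw [hZ]; ring
    rw [e2]
    exact hCS.trans (hY.trans (mul_le_mul_of_nonneg_right hqq (sq_nonneg _)))
  have hab0 : 0 ≤ ∑ z, av z * bv z := Finset.sum_nonneg fun z _ => mul_nonneg (hav0 z) (norm_nonneg _)
  have hab : ∑ z, av z * bv z ≤ Z := (pow_le_pow_iff_left₀ hab0 hZ0 two_ne_zero).mp hsq
  rw [hmul]
  calc ‖((F ^ Nn) *ᵥ g) x‖ ≤ Real.exp κ * ∑ z, av z * bv z := h1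
    _ ≤ Real.exp κ * Z := mul_le_mul_of_nonneg_left hab (Real.exp_pos _).le
    _ = _ := by rw [hZ, hq]; ring

end Pieces

end Summit.QuantumFields.BalabanUV.Beta.GAN24.ScalarSup110GPieces

end
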